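import Literature.Probability.Percolation.ArmSeparationExtSectors
import HarnessLib

/-!
# Tip boxes of different sides are disjoint (rotation frames)

Topic `Literature/Probability/Percolation`; family `crit-perc` / near-critical percolation on `𝕋`.
A brick of the near-critical arm-separation theorem for four arms in the ADJACENT colour
arrangement (P. Nolin, EJP 13 (2008), Thm. 11, `j = 4`, `σ = BBWW` [arXiv 0711.4948: Thm. 10],
§4.4 Lemma 15 [arXiv Lemma 14], two arms of one colour behind two different sides): the squares of
half-width `2κ + 1` about two middle tips `(2M, t_O)`, `(2M, t_C)` (`-2M + 8κ ≤ t ≤ -8κ`, `1 ≤ κ`) read in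
the ROTATION frames `ρ^{io}`, `ρ^{ic}` of two different sides `io ≠ ic` have no common actual site
(`rot_tipBox_ne`; the rotation-frame twin of `frameIso_tipBox_ne`, `FrameTipBoxes.lean`). This is
the input `fence_far` of the cross structure `CrossData` when its two frames are rotation frames.

Everything here is proved; no named facts are introduced.

## References

* P. Nolin, Near-critical percolation in two dimensions, *Electron. J. Probab.* 13 (2008), §4.4
  Lemma 15 (arXiv 0711.4948: Lemma 14) [Nolin2008].
-/

noncomputable section

namespace Literature.Probability.Percolation

open LatticeModels

set_option maxHeartbeats 1600000 in
/-- **Tip boxes of different sides are disjoint** (rotation frames). [folklore] -/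
theorem rot_tipBox_ne {M κ : ℕ} {tO tC : ℤ} (hκ : 1 ≤ κ)
    (hto : -(2 * (M : ℤ)) + 8 * κ ≤ tO ∧ tO ≤ -(8 * (κ : ℤ))) (htc : -(2 * (M : ℤ)) + 8 * κ ≤ tC ∧ tC ≤ -(8 * (κ : ℤ)))
    {v w : Site 2}
    (hv : 2 * (M : ℤ) - (2 * κ + 1) ≤ v 0 ∧ v 0 ≤ 2 * M + (2 * κ + 1) ∧ tO - (2 * κ + 1) ≤ v 1 ∧ v 1 ≤ tO + (2 * κ + 1))
    (hw : 2 * (M : ℤ) - (2 * κ + 1) ≤ w 0 ∧ w 0 ≤ 2 * M + (2 * κ + 1) ∧ tC - (2 * κ + 1) ≤ w 1 ∧ w 1 ≤ tC + (2 * κ + 1))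
    {io ic : ℕ} (hio : io < 6) (hic : ic < 6) (hne : io ≠ ic) (heq : triRotIsoPow io v = triRotIsoPow ic w) : False := by
  obtain ⟨v00, v01, v10, v11, v20, v21, v30, v31, v40, v41, v50, v51⟩ := rot_apply_formula v
  obtain ⟨w00, w01, w10, w11, w20, w21, w30, w31, w40, w41, w50, w51⟩ := rot_apply_formula w
  have h0 : (triRotIsoPow io v) 0 = (triRotIsoPow ic w) 0 := by rw [heq]
  have h1 : (triRotIsoPow io v) 1 = (triRotIsoPow ic w) 1 := by rw [heq]
  obtain ⟨hv0, hv0', hv1, hv1'⟩ := hv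
  obtain ⟨hw0, hw0', hw1, hw1'⟩ := hw
  interval_cases io <;> interval_cases ic <;> first | exact hne rfl | omega

end Literature.Probability.Percolation
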